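import Summits.QuantumFields.BalabanUV.T4Continuum.Support.CTDecayEnd
import Summits.QuantumFields.BalabanUV.T4Continuum.Spine.NE2BalabanDecayRateTheta
import Summits.QuantumFields.BalabanUV.T4Continuum.Support.OutputRateDecayBalaban

/-!
# T⁴ programme, spine node NE2 (U1a), sub-row Δ3 «NE2-WALK» (T4-DAG `T4-U1a.S-NE2-D3-WALK°`) — THE TWO DOWNSTREAM SOCKETS OF THE DECAY
# CURRENCY WITH `hdec` DISCHARGED: the owner's rate-`θ` stations (O12-a) and the junction NE5(O1-b) ⇐ NE2(Δ3), both at the rate `kappaCT` below `etaCT`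

NE2 formalisation swarm `b2b-balaban-t4-ne2-formalise-*`, leaf prover 06 (gen 4), supplier item «Δ3-CT-EXPLICIT» file 4 (follower of file 3
`CTDecayEnd`: `hdec_balabanPert_CT`, `balaban_final_decayStations_of_regular_CT`).  Two landed consumers of the decay currency display the SAME binder
`hdec` as the owner's END (p218845): the owner g12's rate-`θ` twin `Spine/NE2BalabanDecayRateTheta.balaban_final_decayStations_of_regular_rate`
(O12-a, p220672: ROOT B's decay stations at every rate `θ ∈ [L⁻¹, 1)` of node NE3's supply `LocalRate … C θ`) and the owner g11's junction
`Support/OutputRateDecayBalaban.levelEntryRate_balaban_final_of_regular` ∕ `weightedEntrywiseRate_…` (p219833: NE5's consecutive-level entry socket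
`B13OpDatumJunctions.LevelEntryRate` ∕ `WeightedEntrywiseRate` in the decay format, for a FAMILY `U ↦ Rg U` of backgrounds with common sizes).  THIS FILE
feeds `hdec` in both BY NAME with file 3's `hdec_balabanPert_CT` (amplitude `BCT`, rate `kappaCT`, threshold `etaCT ≤ etaStar`):
 * §1 **`balaban_final_decayStations_of_regular_rate_CT (hd) (hreg) (hC) (hθ) (hθ1) (hNE3θ) (ha′) (hαη) (hβη) (hη : η ≤ etaCT o d a a′) (ht)`** and
   **`balaban_final_twoLevelDecayRate_one_rate_CT`** — the rate-`θ` stations ∕ the literal King (4.38) display at `t = 1`, rate `θ`, with NO `hdec`;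
 * §2 **`levelEntryRate_balaban_final_of_regular_CT (hL) (hd) (hreg : ∀ U, …) (hC) (hNE3 : ∀ U, …) (ha′) (hαη) (hβη) (hη : η ≤ etaCT o d a a′) (W)`**
   and **`weightedEntrywiseRate_balaban_final_of_regular_CT`** — NE5's entry socket in the decay format `e^{−(κ_CT/2)·distKC}` with constant
   `√(2·BCT·2C_B(1)/(1−L⁻¹))` and rate `(√(L⁻¹))^k`, displaying the family's `hreg`, `hNE3` (OPEN), `a′`, the threshold — NO `hdec`.

HONEST FRAMING (T4-DAG p. 1).  Bookkeeping over landed modules ([folklore]); statements and constants OURS; MODEL level (no B0); `kappaCT` ∕ `etaCT`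
exist as functions of `(|o|, d, a, a′)`, not extracted as numbers; every station CONDITIONAL on node NE3 BY NAME (`hNE3` ∕ `hNE3θ`, OPEN) and on the
(3.35)-class; neither NE2 (U1a) nor NE5 is proved by this; Δ3 NOT a spine row; spine PROVED 0/9 unchanged; NOT infinite volume, NOT a mass gap, NOT
the Clay problem, NOT summit progress.  HONEST DEPENDENCY: continuum YM on T⁴ ⇐ BetaPertH ∧ nine spine estimates (0/9 proved); BetaPertH ⇐ (D1) ∧
(D4) ∧ CAP+tail; G-an2-4 gates asym, D1 and NE2/3/4.  ABSOLUTE RULE kept; no `def`; no `sorry`.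
-/

noncomputable section

open scoped BigOperators ComplexConjugate Matrix Matrix.Norms.L2Operator Kronecker

namespace Summit.QuantumFields.BalabanUV.T4Continuum.CTDecayEndSockets

open Literature.MathematicalPhysics.QuantumFieldTheory.Balaban1983to89.B5Prop11Plancherel (Cst Tor fine)
open Literature.MathematicalPhysics.QuantumFieldTheory.Balaban1983to89.B5G183RateUnitTower (lev)
open Literature.MathematicalPhysics.QuantumFieldTheory.Balaban1983to89.T4EtaRateMin (LocalRate)
open Summit.QuantumFields.BalabanUV.T4Continuum
open Summit.QuantumFields.BalabanUV.T4Continuum.BalabanAveragedTowerUnit (idx)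
open Summit.QuantumFields.BalabanUV.T4Continuum.BackgroundResolventTower
open Summit.QuantumFields.BalabanUV.T4Continuum.KingPairingPlantedLaw (CJ)
open Summit.QuantumFields.BalabanUV.T4Continuum.GramPerturbationLaw (C2gram)
open Summit.QuantumFields.BalabanUV.T4Continuum.NE2FromNE3 (bgReadings)
open Summit.QuantumFields.BalabanUV.T4Continuum.NE2ColourPerturbedLayer (pertCovC pertLimC)
open Summit.QuantumFields.BalabanUV.T4Continuum.RegularBackgroundTower (RegularTransporters regClass betaNE3)
open Summit.QuantumFields.BalabanUV.T4Continuum.GaugeTermScalarData (QuT Q1)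
open Summit.QuantumFields.BalabanUV.T4Continuum.RegularSiteTransporters (siteT)
open Summit.QuantumFields.BalabanUV.T4Continuum.NestedContourTransport (theta0)
open Summit.QuantumFields.BalabanUV.T4Continuum.NE2BalabanRoot (balabanPert)
open Summit.QuantumFields.BalabanUV.T4Continuum.NE2BalabanGauge (gaugeSlot liftR)
open Summit.QuantumFields.BalabanUV.T4Continuum.NE2BalabanLayerSharp (kappaBs C2Bs)
open Summit.QuantumFields.BalabanUV.T4Continuum.NE2BalabanWiring (epsR CdeltaR)
open Summit.QuantumFields.BalabanUV.T4Continuum.NE2BalabanFinal (kappa4F C4F)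
open Summit.QuantumFields.BalabanUV.T4Continuum.NE2BalabanDecayRateTheta (balaban_final_decayStations_of_regular_rate)
open Summit.QuantumFields.BalabanUV.T4Continuum.DecayRateInterpolation (EntryDecay DecayRate TwoLevelDecayRate)
open Summit.QuantumFields.BalabanUV.T4Continuum.B13OpDatumJunctions (LevelEntryRate WeightedEntrywiseRate weightedEntrywiseRate_of_levels)
open Summit.QuantumFields.BalabanUV.T4Continuum.OutputRateDecayBalaban (decayFormat levelEntryRate_of_twoLevelDecayRate)
open Summit.QuantumFields.BalabanUV.T4Continuum.CTKingTowerWeights (distKC)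
open Summit.QuantumFields.BalabanUV.T4Continuum.CTAdmissibleRate (kappaCT)
open Summit.QuantumFields.BalabanUV.T4Continuum.CTSmallFieldThreshold (etaCT etaCT_le_etaStar)
open Summit.QuantumFields.BalabanUV.T4Continuum.CTDecayEnd (BCT hdec_balabanPert_CT balaban_final_decayStations_of_regular_CT)

variable {d : ℕ} (L : ℕ) [NeZero L] (M : Fin d → ℕ) [hM : ∀ μ, NeZero (M μ)] (a : ℝ) (ha : 0 < a)
variable {o : Type*} [Fintype o] [DecidableEq o] {Bg : Type*}

/-! ## §1 The rate-`θ` stations with `hdec` discharged -/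

/-- **ROOT B IN THE DECAY CURRENCY AT EVERY RATE `θ ∈ [L⁻¹, 1)` OF NE3's SUPPLY, NO `hdec`** (`d ≥ 1`): the owner's
`NE2BalabanDecayRateTheta.balaban_final_decayStations_of_regular_rate` (binders `hreg`, `hNE3θ : LocalRate … C θ` BY NAME and OPEN, `a′ > 0`,
`α, β ≤ η`, `‖t‖ ≤ 1`) with `η ≤ etaCT o d a a′` and its `hdec` FED at `(BCT, kappaCT)` against `distKC`.  Model level; CONDITIONAL on NE3 + the
(3.35)-class + the threshold; NE2 (U1a) NOT proved by this. [cite: King1986, Lemma 4.5 (4.38) p.674 (shape)] [folklore] -/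
theorem balaban_final_decayStations_of_regular_rate_CT (hd : 1 ≤ d)
    {Rg : (k : ℕ) → Fin d → (Tor (fine (lev L k) M) → Matrix o o ℂ)}
    {α β : ℝ} (hreg : RegularTransporters L M (liftR L M Rg) α β) {C θ : ℝ} (hC : 0 ≤ C) (hθ : ((L : ℝ)⁻¹) ≤ θ) (hθ1 : θ < 1)
    (hNE3θ : LocalRate (bgReadings L M (regClass L M (liftR L M Rg))) C θ) {a' : ℝ} (ha' : 0 < a')
    {η : ℝ} (hαη : α ≤ η) (hβη : β ≤ η) (hη : η ≤ etaCT o d a a') {t : ℂ} (ht : ‖t‖ ≤ 1) :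
    EntryDecay (distKC L M o)
        (pertLimC L M a ha (balabanPert L M a (liftR L M Rg) (gaugeSlot L M Rg (QuT L M o (siteT L M Rg)) (Q1 L M o) a')) t)
        (BCT (Fintype.card o) d a a') (kappaCT (Fintype.card o) d a a') ∧
      DecayRate (distKC L M o)
        (pertCovC L M a ha (balabanPert L M a (liftR L M Rg) (gaugeSlot L M Rg (QuT L M o (siteT L M Rg)) (Q1 L M o) a')) t)
        (pertLimC L M a ha (balabanPert L M a (liftR L M Rg) (gaugeSlot L M Rg (QuT L M o (siteT L M Rg)) (Q1 L M o) a')) t)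
        (Real.sqrt (2 * BCT (Fintype.card o) d a a' *
          (Cpert (kappaBs o d a α β (a * (epsR o d α * (2 + epsR o d α) * Cst d a)) (kappa4F d a a' α β)) (2 * d * Cst d a) (CJ d a)
              (C2Bs o d L a α β C
                (a * C2gram (Cst d a) 1 (epsR o d α) (2 * d * Cst d a) (CJ d a) (Cst d a) (CdeltaR o d a α (theta0 d α (betaNE3 o C))))
                (C4F o d L a a' α β C)) 0 t / (1 - θ))))
        (kappaCT (Fintype.card o) d a a' / 2) (Real.sqrt θ) ∧
      TwoLevelDecayRate (distKC L M o)
        (pertCovC L M a ha (balabanPert L M a (liftR L M Rg) (gaugeSlot L M Rg (QuT L M o (siteT L M Rg)) (Q1 L M o) a')) t)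
        (Real.sqrt (2 * BCT (Fintype.card o) d a a' * (2 *
          Cpert (kappaBs o d a α β (a * (epsR o d α * (2 + epsR o d α) * Cst d a)) (kappa4F d a a' α β)) (2 * d * Cst d a) (CJ d a)
              (C2Bs o d L a α β C
                (a * C2gram (Cst d a) 1 (epsR o d α) (2 * d * Cst d a) (CJ d a) (Cst d a) (CdeltaR o d a α (theta0 d α (betaNE3 o C))))
                (C4F o d L a a' α β C)) 0 t / (1 - θ))))
        (kappaCT (Fintype.card o) d a a' / 2) (Real.sqrt θ) :=
  balaban_final_decayStations_of_regular_rate L M a ha hd hreg hC hθ hθ1 hNE3θ ha' hαη hβη (hη.trans (etaCT_le_etaStar o d a a')) ht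
    (hdec_balabanPert_CT L M a ha hd hreg ha' hαη hβη hη ht)

/-- **THE LITERAL KING (4.38) DISPLAY AT `t = 1`, RATE `θ`, NO `hdec`**: `∃ B₀, ‖(c_{k+1} − c_k)(x,y)‖ ≤ B₀·(√θ)^k·e^{−(κ_CT/2)·distKC(x,y)}`.
Model level; CONDITIONAL on NE3 (`LocalRate … C θ`) + the (3.35)-class + the threshold; NE2 (U1a) NOT proved by this.
[cite: King1986, Lemma 4.5 (4.38) p.674 (shape)] [folklore] -/
theorem balaban_final_twoLevelDecayRate_one_rate_CT (hd : 1 ≤ d)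
    {Rg : (k : ℕ) → Fin d → (Tor (fine (lev L k) M) → Matrix o o ℂ)}
    {α β : ℝ} (hreg : RegularTransporters L M (liftR L M Rg) α β) {C θ : ℝ} (hC : 0 ≤ C) (hθ : ((L : ℝ)⁻¹) ≤ θ) (hθ1 : θ < 1)
    (hNE3θ : LocalRate (bgReadings L M (regClass L M (liftR L M Rg))) C θ) {a' : ℝ} (ha' : 0 < a')
    {η : ℝ} (hαη : α ≤ η) (hβη : β ≤ η) (hη : η ≤ etaCT o d a a') :
    ∃ B₀ : ℝ, ∀ k (x y : idx L M 0 × o),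
      ‖(pertCovC L M a ha (balabanPert L M a (liftR L M Rg) (gaugeSlot L M Rg (QuT L M o (siteT L M Rg)) (Q1 L M o) a')) 1 (k + 1)
          - pertCovC L M a ha (balabanPert L M a (liftR L M Rg) (gaugeSlot L M Rg (QuT L M o (siteT L M Rg)) (Q1 L M o) a')) 1 k) x y‖
        ≤ B₀ * Real.sqrt θ ^ k * Real.exp (-(kappaCT (Fintype.card o) d a a' / 2 * distKC L M o x y)) := by
  have h1 : ‖(1 : ℂ)‖ ≤ 1 := by rw [norm_one]
  obtain ⟨-, -, h⟩ := balaban_final_decayStations_of_regular_rate_CT L M a ha hd hreg hC hθ hθ1 hNE3θ ha' hαη hβη hη h1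
  exact ⟨_, h⟩

/-! ## §2 NE5's entry socket in the decay format with `hdec` discharged -/

/-- **THE JUNCTION NE5(O1-b) ⇐ NE2(tier B) IN THE DECAY CURRENCY, NO `hdec`** (`L ≥ 2`, `d ≥ 1`, `a′ > 0`): for a family `U ↦ Rg U` of bond
transporter data in the (3.35)-shape class with common sizes `α, β ≤ η ≤ etaCT o d a a′` and node NE3's `LocalRate … C L⁻¹` BY NAME for every
member (OPEN), NE5's consecutive-level entry socket holds with the decay format `e^{−(κ_CT/2)·distKC}`, constant `√(2·BCT·2C_B(1)/(1−L⁻¹))` and rate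
`(√(L⁻¹))^k` — the owner's `OutputRateDecayBalaban.levelEntryRate_of_twoLevelDecayRate` on file 3's stations at `t = 1`.  Model level; CONDITIONAL on
NE3 + the (3.35)-class + the threshold; neither NE2 nor NE5 is proved by this. [cite: King1986, Lemma 4.5 (4.38) p.674 (shape)] [folklore] -/
theorem levelEntryRate_balaban_final_of_regular_CT (hL : 2 ≤ L) (hd : 1 ≤ d)
    {Rg : Bg → (k : ℕ) → Fin d → (Tor (fine (lev L k) M) → Matrix o o ℂ)}
    {α β : ℝ} (hreg : ∀ U, RegularTransporters L M (liftR L M (Rg U)) α β) {C : ℝ} (hC : 0 ≤ C)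
    (hNE3 : ∀ U, LocalRate (bgReadings L M (regClass L M (liftR L M (Rg U)))) C ((L : ℝ)⁻¹)) {a' : ℝ} (ha' : 0 < a')
    {η : ℝ} (hαη : α ≤ η) (hβη : β ≤ η) (hη : η ≤ etaCT o d a a') (W : Set (ℕ → ℝ)) :
    LevelEntryRate (fun _ => decayFormat (distKC L M o) (kappaCT (Fintype.card o) d a a' / 2))
      (fun (_ : ℕ → ℝ) (U : Bg) (k : ℕ) (e : (idx L M 0 × o) × (idx L M 0 × o)) =>
        pertCovC L M a ha (balabanPert L M a (liftR L M (Rg U)) (gaugeSlot L M (Rg U) (QuT L M o (siteT L M (Rg U))) (Q1 L M o) a')) 1 k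
          e.1 e.2)
      W
      (Real.sqrt (2 * BCT (Fintype.card o) d a a' * (2 *
          Cpert (kappaBs o d a α β (a * (epsR o d α * (2 + epsR o d α) * Cst d a)) (kappa4F d a a' α β)) (2 * d * Cst d a) (CJ d a)
              (C2Bs o d L a α β C
                (a * C2gram (Cst d a) 1 (epsR o d α) (2 * d * Cst d a) (CJ d a) (Cst d a) (CdeltaR o d a α (theta0 d α (betaNE3 o C))))
                (C4F o d L a a' α β C)) 0 1 / (1 - (L : ℝ)⁻¹))))
      (fun k => Real.sqrt ((L : ℝ)⁻¹) ^ k) := by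
  have h1 : ‖(1 : ℂ)‖ ≤ 1 := by rw [norm_one]
  refine levelEntryRate_of_twoLevelDecayRate fun _ _ U => ?_
  exact (balaban_final_decayStations_of_regular_CT L M a ha hL hd (hreg U) hC (hNE3 U) ha' hαη hβη hη h1).2.2

/-- … and the two-run form (`WeightedEntrywiseRate`: run A reads `k+1` levels, run B reads `k` levels), NO `hdec`. [folklore] -/
theorem weightedEntrywiseRate_balaban_final_of_regular_CT (hL : 2 ≤ L) (hd : 1 ≤ d)
    {Rg : Bg → (k : ℕ) → Fin d → (Tor (fine (lev L k) M) → Matrix o o ℂ)}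
    {α β : ℝ} (hreg : ∀ U, RegularTransporters L M (liftR L M (Rg U)) α β) {C : ℝ} (hC : 0 ≤ C)
    (hNE3 : ∀ U, LocalRate (bgReadings L M (regClass L M (liftR L M (Rg U)))) C ((L : ℝ)⁻¹)) {a' : ℝ} (ha' : 0 < a')
    {η : ℝ} (hαη : α ≤ η) (hβη : β ≤ η) (hη : η ≤ etaCT o d a a') (W : Set (ℕ → ℝ)) :
    WeightedEntrywiseRate (fun _ => decayFormat (distKC L M o) (kappaCT (Fintype.card o) d a a' / 2))
      (fun (_ : ℕ → ℝ) (U : Bg) (k : ℕ) (e : (idx L M 0 × o) × (idx L M 0 × o)) =>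
        pertCovC L M a ha (balabanPert L M a (liftR L M (Rg U)) (gaugeSlot L M (Rg U) (QuT L M o (siteT L M (Rg U))) (Q1 L M o) a')) 1 k
          e.1 e.2)
      (fun (_ : ℕ → ℝ) (U : Bg) (k : ℕ) (e : (idx L M 0 × o) × (idx L M 0 × o)) =>
        pertCovC L M a ha (balabanPert L M a (liftR L M (Rg U)) (gaugeSlot L M (Rg U) (QuT L M o (siteT L M (Rg U))) (Q1 L M o) a')) 1
          (k + 1) e.1 e.2)
      W
      (Real.sqrt (2 * BCT (Fintype.card o) d a a' * (2 *
          Cpert (kappaBs o d a α β (a * (epsR o d α * (2 + epsR o d α) * Cst d a)) (kappa4F d a a' α β)) (2 * d * Cst d a) (CJ d a)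
              (C2Bs o d L a α β C
                (a * C2gram (Cst d a) 1 (epsR o d α) (2 * d * Cst d a) (CJ d a) (Cst d a) (CdeltaR o d a α (theta0 d α (betaNE3 o C))))
                (C4F o d L a a' α β C)) 0 1 / (1 - (L : ℝ)⁻¹))))
      (fun k => Real.sqrt ((L : ℝ)⁻¹) ^ k) :=
  weightedEntrywiseRate_of_levels (levelEntryRate_balaban_final_of_regular_CT L M a ha hL hd hreg hC hNE3 ha' hαη hβη hη W)

end Summit.QuantumFields.BalabanUV.T4Continuum.CTDecayEndSockets

end
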